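import Mathlib
import Summits.ValiantsHypothesis.ValiantsHypothesis.Theorems.LiouvilleSarnakLiouvilleCutRankSwapStability
import Summits.ValiantsHypothesis.ValiantsHypothesis.Theorems.LiouvilleSarnakLiouvilleCutRankDefectiveWindow

/-!
# Route LiouvilleSarnak — crux `LiouvilleCutRank` (stmt-ValiantsHypothesis-14775):
# the LETTER-FLIP lemma — exchanging the letters of two equinumerous position sets costs `4^{m}` in rank

A reusable packaging of `…SwapStability` + the pairing of `…DefectiveWindow` §1: given a cut `π`, a set `S₁` of
`m` ROW positions and a set `S₂` of `m` COLUMN positions, there is a cut `π'` (obtained from `π` by `m`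
row/column swaps) whose word is that of `π` with the letters on `S₁` and `S₂` exchanged, and
`rank M_{π'} ≤ 4^m · rank M_π`, `rank M_π ≤ 4^m · rank M_{π'}`.

* `card_rowsIn_add_card_colsIn_eq` — `#{i : π(inl i) ∈ S} + #{j : π(inr j) ∈ S} = #S`.
* ★ `exists_flip` — the letter-flip lemma (word of the new cut given position-wise).

Honest framing: bookkeeping for the robustness theorems of the OPEN crux; `LiouvilleCutRank`,
`DigitalBilinearLiouville`, `AlgebraicSarnak` stay OPEN; nothing bears on `VP ≠ VNP`.  No definitions.
-/

set_option linter.dupNamespace false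

noncomputable section

namespace Summit.ValiantsHypothesis.ValiantsHypothesis.Theorems.LiouvilleSarnakLiouvilleCutRank.LetterFlip

open ArithmeticFunction Finset

open Summit.ValiantsHypothesis.ValiantsHypothesis.Theorems.LiouvilleSarnakLiouvilleCutRank.SwapStability
  (rank_swaps_le rank_le_pow_mul_rank_swaps)
open Summit.ValiantsHypothesis.ValiantsHypothesis.Theorems.LiouvilleSarnakLiouvilleCutRank.DefectiveWindow
  (foldr_swaps_apply_inl_of_not_mem foldr_swaps_apply_inr_of_not_mem foldr_swaps_apply_of_mem)

/-- Every position is a row position or a column position: `#{i : π(inl i) ∈ S} + #{j : π(inr j) ∈ S} = #S`.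
[folklore] -/
theorem card_rowsIn_add_card_colsIn_eq {n : ℕ} (π : Fin n ⊕ Fin n ≃ Fin (2 * n))
    (S : Finset (Fin (2 * n))) :
    (univ.filter fun i : Fin n => π (Sum.inl i) ∈ S).card +
      (univ.filter fun j : Fin n => π (Sum.inr j) ∈ S).card = S.card := by
  classical
  rw [← card_disjSum]
  refine card_nbij' (fun x => π x) (fun k => π.symm k) ?_ ?_ ?_ ?_
  · intro x hx
    rw [mem_coe, mem_disjSum] at hx
    rcases hx with ⟨i, hi, rfl⟩ | ⟨j, hj, rfl⟩
    · exact (mem_filter.mp hi).2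
    · exact (mem_filter.mp hj).2
  · intro k hk
    rw [mem_coe] at hk
    rw [mem_coe, mem_disjSum]
    rcases hx : π.symm k with i | j
    · exact Or.inl ⟨i, mem_filter.mpr ⟨mem_univ _, by rw [← hx, Equiv.apply_symm_apply]; exact hk⟩, hx.symm⟩
    · exact Or.inr ⟨j, mem_filter.mpr ⟨mem_univ _, by rw [← hx, Equiv.apply_symm_apply]; exact hk⟩, hx.symm⟩
  · intro x _; exact π.symm_apply_apply x
  · intro k _; exact π.apply_symm_apply k

/-- ★ **Letter flip.**  Let `S₁` be a set of row positions and `S₂` a set of column positions of the cut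
`π`, with `#S₁ = #S₂ = m`.  Then some cut `π'`, obtained from `π` by `m` row/column swaps, has the word of
`π` with the letters on `S₁ ∪ S₂` exchanged — position `k` is a row position of `π'` iff
(`k ∈ S₂`) or (`k ∉ S₁` and `k` is a row position of `π`) — and
`rank M_{π'} ≤ 4^m rank M_π`, `rank M_π ≤ 4^m rank M_{π'}`. [this file] -/
theorem exists_flip {n : ℕ} (π : Fin n ⊕ Fin n ≃ Fin (2 * n)) (S₁ S₂ : Finset (Fin (2 * n)))
    (h₁ : ∀ k ∈ S₁, (π.symm k).isLeft = true) (h₂ : ∀ k ∈ S₂, (π.symm k).isLeft = false)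
    (hcard : S₁.card = S₂.card) :
    ∃ π' : Fin n ⊕ Fin n ≃ Fin (2 * n),
      (∀ k : Fin (2 * n), (π'.symm k).isLeft = (decide (k ∈ S₂) || (!decide (k ∈ S₁) && (π.symm k).isLeft))) ∧
      (Matrix.of fun r c : Fin n → Bool =>
        (((liouville (Nat.ofBits (fun k : Fin (2 * n) => Sum.elim r c (π'.symm k)) + 1) : ℤ) : ℂ))).rank ≤
        4 ^ S₁.card * (Matrix.of fun r c : Fin n → Bool =>
          (((liouville (Nat.ofBits (fun k : Fin (2 * n) => Sum.elim r c (π.symm k)) + 1) : ℤ) : ℂ))).rank ∧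
      (Matrix.of fun r c : Fin n → Bool =>
        (((liouville (Nat.ofBits (fun k : Fin (2 * n) => Sum.elim r c (π.symm k)) + 1) : ℤ) : ℂ))).rank ≤
        4 ^ S₁.card * (Matrix.of fun r c : Fin n → Bool =>
          (((liouville (Nat.ofBits (fun k : Fin (2 * n) => Sum.elim r c (π'.symm k)) + 1) : ℤ) : ℂ))).rank := by
  classical
  -- indices sitting in `S₁` (rows) and `S₂` (columns)
  set Is := univ.filter fun i : Fin n => π (Sum.inl i) ∈ S₁ with hIs
  set Js := univ.filter fun j : Fin n => π (Sum.inr j) ∈ S₂ with hJs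
  have hnocol : (univ.filter fun j : Fin n => π (Sum.inr j) ∈ S₁).card = 0 := by
    rw [card_eq_zero, filter_eq_empty_iff]
    intro j _ hj
    have := h₁ _ hj
    rw [Equiv.symm_apply_apply] at this
    exact Bool.false_ne_true this
  have hnorow : (univ.filter fun i : Fin n => π (Sum.inl i) ∈ S₂).card = 0 := by
    rw [card_eq_zero, filter_eq_empty_iff]
    intro i _ hi
    have := h₂ _ hi
    rw [Equiv.symm_apply_apply] at this
    simp at this
  have hIcard : Is.card = S₁.card := by
    have := card_rowsIn_add_card_colsIn_eq π S₁; rw [hnocol] at this; simpa [hIs] using this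
  have hJcard : Js.card = S₂.card := by
    have := card_rowsIn_add_card_colsIn_eq π S₂; rw [hnorow] at this; simpa [hJs] using this
  -- the swap list
  set Lw : List (Fin n × Fin n) := Is.toList.zip Js.toList with hLw
  have hlen1 : Is.toList.length = Js.toList.length := by
    rw [length_toList, length_toList, hIcard, hJcard, hcard]
  have hfst : Lw.map Prod.fst = Is.toList := by
    rw [hLw]; exact List.map_fst_zip (le_of_eq hlen1)
  have hsnd : Lw.map Prod.snd = Js.toList := by
    rw [hLw]; exact List.map_snd_zip (le_of_eq hlen1.symm)
  have hL1 : (Lw.map Prod.fst).Nodup := by rw [hfst]; exact nodup_toList _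
  have hL2 : (Lw.map Prod.snd).Nodup := by rw [hsnd]; exact nodup_toList _
  have hlen : Lw.length = S₁.card := by
    rw [hLw, List.length_zip, hlen1, min_self, length_toList, hJcard, hcard]
  set π' := Lw.foldr (fun q e => (Equiv.swap (Sum.inl q.1) (Sum.inr q.2)).trans e) π with hπ'
  have hmemLw : ∀ q ∈ Lw, q.1 ∈ Is ∧ q.2 ∈ Js := by
    intro q hq
    have := List.of_mem_zip (by rw [← hLw]; exact hq)
    rw [mem_toList, mem_toList] at this
    exact this
  refine ⟨π', fun k => ?_, ?_, ?_⟩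
  · rcases hx : π'.symm k with i | j
    · -- `k` is a row position of `π'`
      rw [Sum.isLeft_inl]
      have hk : π' (Sum.inl i) = k := by rw [← hx, Equiv.apply_symm_apply]
      by_cases hi : i ∈ Lw.map Prod.fst
      · obtain ⟨q, hq, hqi⟩ := List.mem_map.mp hi
        have hmem : (i, q.2) ∈ Lw := by rw [← hqi]; exact hq
        have h := (foldr_swaps_apply_of_mem π Lw hL1 hL2 i q.2 hmem).1
        rw [← hπ', hk] at h
        -- `k = π (inr q.2)` with `q.2 ∈ Js`, so `k ∈ S₂`
        have hk2 : k ∈ S₂ := by rw [h]; exact (mem_filter.mp (hmemLw q hq).2).2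
        simp [hk2]
      · have h := foldr_swaps_apply_inl_of_not_mem π Lw i hi
        rw [← hπ', hk] at h
        -- `k = π (inl i)`, `i ∉ Is`: `k ∉ S₁`, `k ∉ S₂`, and `k` is a row of `π`
        have hk1 : k ∉ S₁ := by
          intro hk1
          apply hi
          rw [hfst, mem_toList, hIs, mem_filter]
          exact ⟨mem_univ _, by rw [← h]; exact hk1⟩
        have hk2 : k ∉ S₂ := by
          intro hk2
          have := h₂ k hk2
          rw [h, Equiv.symm_apply_apply] at this
          exact Bool.noConfusion this
        have hrow : (π.symm k).isLeft = true := by rw [h, Equiv.symm_apply_apply]; rfl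
        simp [hk1, hk2, hrow]
    · rw [Sum.isLeft_inr]
      have hk : π' (Sum.inr j) = k := by rw [← hx, Equiv.apply_symm_apply]
      by_cases hj : j ∈ Lw.map Prod.snd
      · obtain ⟨q, hq, hqj⟩ := List.mem_map.mp hj
        have hmem : (q.1, j) ∈ Lw := by rw [← hqj]; exact hq
        have h := (foldr_swaps_apply_of_mem π Lw hL1 hL2 q.1 j hmem).2
        rw [← hπ', hk] at h
        -- `k = π (inl q.1)` with `q.1 ∈ Is`: `k ∈ S₁`, not in `S₂`
        have hk1 : k ∈ S₁ := by rw [h]; exact (mem_filter.mp (hmemLw q hq).1).2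
        have hk2 : k ∉ S₂ := by
          intro hk2
          have := h₂ k hk2
          rw [h, Equiv.symm_apply_apply] at this
          exact Bool.noConfusion this
        simp [hk1, hk2]
      · have h := foldr_swaps_apply_inr_of_not_mem π Lw j hj
        rw [← hπ', hk] at h
        have hk2 : k ∉ S₂ := by
          intro hk2
          apply hj
          rw [hsnd, mem_toList, hJs, mem_filter]
          exact ⟨mem_univ _, by rw [← h]; exact hk2⟩
        have hcol : (π.symm k).isLeft = false := by rw [h, Equiv.symm_apply_apply]; rfl
        simp [hk2, hcol]
  · have := rank_swaps_le
      (fun v : Fin (2 * n) → Bool => (((liouville (Nat.ofBits v + 1)) : ℤ) : ℂ)) π Lw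
    rw [hlen] at this
    exact this
  · have := rank_le_pow_mul_rank_swaps
      (fun v : Fin (2 * n) → Bool => (((liouville (Nat.ofBits v + 1)) : ℤ) : ℂ)) π Lw
    rw [hlen] at this
    exact this

end Summit.ValiantsHypothesis.ValiantsHypothesis.Theorems.LiouvilleSarnakLiouvilleCutRank.LetterFlip

end
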